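import Mathlib
import Summits.MatrixMultiplication.MatrixMultiplication.Theses.DesignFlattening

/-!
# Route DesignFlattening — support item `EquivoluminousDeterminant` (stmt-MatrixMultiplication-11017)

If a subset `S` of a finite abelian group `G` has Coppersmith–Winograd's
no-three-disjoint-equivoluminous-subsets property (no three pairwise disjoint subsets of `S`, not all
empty, with equal sums), then `(3/2)^|S| ≤ |G|²`.

Proof (the card's determinant argument, made elementary).  For characters `χ, ψ ∈ Ĝ` and `g ∈ G`
let `A(χ,ψ,g)` be the `3 × 3` matrix `((1, χ g, 0), (0, 1, χ(−g)ψ(−g)), (−ψ g, 0, 1))`; it is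
singular and has the explicit rank-two factorisation `A = u₀ ⊗ r₀ + u₁ ⊗ r₁` with
`u₀ = (1, 0, −ψ g)`, `u₁ = (0, 1, ψ g χ g)`, `r₀ = (1, χ g, 0)`, `r₁ = (0, 1, χ(−g)ψ(−g))`.
By character orthogonality and the hypothesis, `Σ_{χ,ψ} ⊗_{i ∈ S} A(χ,ψ,s_i) = |G|² · I`, so every
standard basis vector of `ℂ^{3^S}` lies in the span of the `|Ĝ|² · 2^|S|` product vectors
`⊗_i r_{ε_i}(χ,ψ,s_i)`, whence `3^|S| ≤ |G|² · 2^|S|`.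
Only Mathlib is used (`AddChar.sum_apply_eq_ite`, `AddChar.card_eq`, `finrank_range_le_card`).
-/

-- the tree's namespace `Summit.MatrixMultiplication.MatrixMultiplication.…` repeats a component by design
set_option linter.dupNamespace false

namespace Summit.MatrixMultiplication.MatrixMultiplication.Theorems

open Finset

namespace DesignFlatteningEquivoluminousDeterminant

/-- Additive characters send finite sums to finite products. -/
theorem addChar_map_finset_sum {A M ι : Type*} [AddCommMonoid A] [CommMonoid M] (φ : AddChar A M)
    (s : Finset ι) (f : ι → A) : φ (∑ i ∈ s, f i) = ∏ i ∈ s, φ (f i) := by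
  induction s using Finset.cons_induction with
  | empty => simp
  | cons a s ha ih => rw [Finset.sum_cons, Finset.prod_cons, AddChar.map_add_eq_mul, ih]

/-- Dimension count: if the indicator vector of every point of `κ` lies in the span of a family of
vectors indexed by `J`, then `|κ| ≤ |J|`. -/
theorem card_le_of_indicator_mem_span {κ J : Type*} [Fintype κ] [DecidableEq κ] [Fintype J]
    (R : J → κ → ℂ)
    (h : ∀ c : κ, (fun d => if c = d then (1 : ℂ) else 0) ∈ Submodule.span ℂ (Set.range R)) :
    Fintype.card κ ≤ Fintype.card J := by
  have htop : (⊤ : Submodule ℂ (κ → ℂ)) ≤ Submodule.span ℂ (Set.range R) := by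
    intro f _
    rw [pi_eq_sum_univ f]
    exact Submodule.sum_mem _ fun c _ => Submodule.smul_mem _ _ (h c)
  have h1 : Module.finrank ℂ (κ → ℂ) = Fintype.card κ := Module.finrank_fintype_fun_eq_card ℂ
  have h2 : Module.finrank ℂ (Submodule.span ℂ (Set.range R)) ≤ Fintype.card J :=
    finrank_range_le_card R
  have h3 : Module.finrank ℂ (κ → ℂ) ≤ Module.finrank ℂ (Submodule.span ℂ (Set.range R)) := by
    rw [← finrank_top ℂ (κ → ℂ)]
    exact Submodule.finrank_mono htop
  omega

/-- The combinatorial input: an off-diagonal pair of words `c ≠ d` all of whose letters are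
"compatible" produces three pairwise disjoint, not all empty, index sets; if their sums agree as
stated, the no-three-disjoint-equivoluminous-subsets hypothesis is violated. -/
theorem ntde_contra {ι G : Type*} [Fintype ι] [AddCommGroup G] (s : ι → G)
    (hS : ∀ I₁ I₂ I₃ : Finset ι, Disjoint I₁ I₂ → Disjoint I₂ I₃ → Disjoint I₁ I₃ →
      ¬ (I₁ = ∅ ∧ I₂ = ∅ ∧ I₃ = ∅) →
      ¬ (∑ i ∈ I₁, s i = ∑ i ∈ I₂, s i ∧ ∑ i ∈ I₂, s i = ∑ i ∈ I₃, s i))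
    (c d : ι → Fin 3) (hcd : c ≠ d)
    (hcompat : ∀ i, d i = c i ∨ (c i = 0 ∧ d i = 1) ∨ (c i = 1 ∧ d i = 2) ∨ (c i = 2 ∧ d i = 0))
    (h1 : ∑ i ∈ univ.filter (fun i => c i = 0 ∧ d i = 1), s i =
      ∑ i ∈ univ.filter (fun i => c i = 1 ∧ d i = 2), s i)
    (h2 : ∑ i ∈ univ.filter (fun i => c i = 1 ∧ d i = 2), s i =
      ∑ i ∈ univ.filter (fun i => c i = 2 ∧ d i = 0), s i) : False := by
  refine hS _ _ _ ?_ ?_ ?_ ?_ ⟨h1, h2⟩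
  · rw [Finset.disjoint_filter]
    rintro i - ⟨h0, -⟩ ⟨h0', -⟩
    rw [h0] at h0'
    exact absurd h0' (by decide)
  · rw [Finset.disjoint_filter]
    rintro i - ⟨h0, -⟩ ⟨h0', -⟩
    rw [h0] at h0'
    exact absurd h0' (by decide)
  · rw [Finset.disjoint_filter]
    rintro i - ⟨h0, -⟩ ⟨h0', -⟩
    rw [h0] at h0'
    exact absurd h0' (by decide)
  · rintro ⟨e1, e2, e3⟩
    apply hcd
    funext i
    rcases hcompat i with h | h | h | h
    · exact h.symm
    · have hi : i ∈ univ.filter (fun i => c i = 0 ∧ d i = 1) := by simp [h]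
      rw [e1] at hi
      simp at hi
    · have hi : i ∈ univ.filter (fun i => c i = 1 ∧ d i = 2) := by simp [h]
      rw [e2] at hi
      simp at hi
    · have hi : i ∈ univ.filter (fun i => c i = 2 ∧ d i = 0) := by simp [h]
      rw [e3] at hi
      simp at hi

/-- The character-sum identity `Σ_{χ,ψ} (⊗_i A(χ,ψ,s_i))_{c,d} = |G|²·[c = d]`, with each Kronecker
factor already expanded along its rank-two factorisation `A = Σ_e u_e ⊗ r_e` (the factors `col`,
`row` are passed with their defining equations). -/
theorem kernel_sum {ι G : Type*} [Fintype ι] [DecidableEq ι] [AddCommGroup G] [Fintype G]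
    [DecidableEq G] (s : ι → G)
    (hS : ∀ I₁ I₂ I₃ : Finset ι, Disjoint I₁ I₂ → Disjoint I₂ I₃ → Disjoint I₁ I₃ →
      ¬ (I₁ = ∅ ∧ I₂ = ∅ ∧ I₃ = ∅) →
      ¬ (∑ i ∈ I₁, s i = ∑ i ∈ I₂, s i ∧ ∑ i ∈ I₂, s i = ∑ i ∈ I₃, s i))
    (col row : AddChar G ℂ → AddChar G ℂ → G → Fin 2 → Fin 3 → ℂ)
    (hcol : col = fun χ ψ g => ![![1, 0, -ψ g], ![0, 1, ψ g * χ g]])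
    (hrow : row = fun χ ψ g => ![![1, χ g, 0], ![0, 1, χ (-g) * ψ (-g)]])
    (c d : ι → Fin 3) :
    ∑ χ : AddChar G ℂ, ∑ ψ : AddChar G ℂ, ∑ ε : ι → Fin 2,
      (∏ i, col χ ψ (s i) (ε i) (c i)) * (∏ i, row χ ψ (s i) (ε i) (d i))
      = if c = d then ((Fintype.card G : ℂ) ^ 2) else 0 := by
  -- sign pattern and character arguments of the entries of `A(χ,ψ,g)`
  obtain ⟨sg, hsg⟩ : ∃ sg : Fin 3 → Fin 3 → ℂ, sg = fun a b =>
      if a = b then 1 else if (a = 0 ∧ b = 1) ∨ (a = 1 ∧ b = 2) then 1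
        else if (a = 2 ∧ b = 0) then -1 else 0 := ⟨_, rfl⟩
  obtain ⟨p, hp⟩ : ∃ p : Fin 3 → Fin 3 → G → G, p = fun a b g =>
      (if a = 0 ∧ b = 1 then g else 0) - (if a = 1 ∧ b = 2 then g else 0) := ⟨_, rfl⟩
  obtain ⟨q, hq⟩ : ∃ q : Fin 3 → Fin 3 → G → G, q = fun a b g =>
      (if a = 2 ∧ b = 0 then g else 0) - (if a = 1 ∧ b = 2 then g else 0) := ⟨_, rfl⟩
  -- entrywise: the rank-two factorisation computes `A`, written through the characters
  have hfac : ∀ (χ ψ : AddChar G ℂ) (g : G) (a b : Fin 3),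
      ∑ e : Fin 2, col χ ψ g e a * row χ ψ g e b = sg a b * χ (p a b g) * ψ (q a b g) := by
    intro χ ψ g a b
    have h1 : χ g * χ (-g) = 1 := by
      rw [← AddChar.map_add_eq_mul, add_neg_cancel, AddChar.map_zero_eq_one]
    have h2 : ψ g * ψ (-g) = 1 := by
      rw [← AddChar.map_add_eq_mul, add_neg_cancel, AddChar.map_zero_eq_one]
    have h3 : ψ g * χ g * (χ (-g) * ψ (-g)) = 1 := by
      calc ψ g * χ g * (χ (-g) * ψ (-g)) = (χ g * χ (-g)) * (ψ g * ψ (-g)) := by ring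
        _ = 1 := by rw [h1, h2, one_mul]
    rw [hcol, hrow, hsg, hp, hq, Fin.sum_univ_two]
    fin_cases a <;> fin_cases b <;> simp [h3]
  -- the `ε`-sum is the `(c,d)` entry of the Kronecker product, which factorises
  have hprod : ∀ χ ψ : AddChar G ℂ,
      ∑ ε : ι → Fin 2, (∏ i, col χ ψ (s i) (ε i) (c i)) * (∏ i, row χ ψ (s i) (ε i) (d i))
        = (∏ i, sg (c i) (d i)) * χ (∑ i, p (c i) (d i) (s i)) * ψ (∑ i, q (c i) (d i) (s i)) := by
    intro χ ψ
    calc ∑ ε : ι → Fin 2, (∏ i, col χ ψ (s i) (ε i) (c i)) * (∏ i, row χ ψ (s i) (ε i) (d i))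
        = ∑ ε : ι → Fin 2, ∏ i, (col χ ψ (s i) (ε i) (c i) * row χ ψ (s i) (ε i) (d i)) :=
          Finset.sum_congr rfl fun ε _ => (Finset.prod_mul_distrib).symm
      _ = ∏ i, ∑ e : Fin 2, col χ ψ (s i) e (c i) * row χ ψ (s i) e (d i) :=
          (Fintype.prod_sum fun i e => col χ ψ (s i) e (c i) * row χ ψ (s i) e (d i)).symm
      _ = ∏ i, (sg (c i) (d i) * χ (p (c i) (d i) (s i)) * ψ (q (c i) (d i) (s i))) :=
          Finset.prod_congr rfl fun i _ => hfac χ ψ (s i) (c i) (d i)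
      _ = (∏ i, sg (c i) (d i)) * χ (∑ i, p (c i) (d i) (s i)) * ψ (∑ i, q (c i) (d i) (s i)) := by
          rw [Finset.prod_mul_distrib, Finset.prod_mul_distrib, addChar_map_finset_sum,
            addChar_map_finset_sum]
  simp_rw [hprod]
  -- character orthogonality
  set E := ∏ i, sg (c i) (d i) with hE
  set P := ∑ i, p (c i) (d i) (s i) with hP
  set Q := ∑ i, q (c i) (d i) (s i) with hQ
  have hsum : ∑ χ : AddChar G ℂ, ∑ ψ : AddChar G ℂ, E * χ P * ψ Q
      = E * ((∑ χ : AddChar G ℂ, χ P) * (∑ ψ : AddChar G ℂ, ψ Q)) := by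
    rw [Finset.sum_mul_sum, Finset.mul_sum]
    refine Finset.sum_congr rfl fun χ _ => ?_
    rw [Finset.mul_sum]
    refine Finset.sum_congr rfl fun ψ _ => ?_
    ring
  rw [hsum, AddChar.sum_apply_eq_ite, AddChar.sum_apply_eq_ite]
  -- diagonal behaviour of the three tables
  have hdiag : ∀ a : Fin 3, sg a a = 1 ∧ ∀ g : G, p a a g = 0 ∧ q a a g = 0 := by
    intro a
    rw [hsg, hp, hq]
    fin_cases a <;> simp
  have hsg0 : ∀ a b : Fin 3, sg a b ≠ 0 →
      b = a ∨ (a = 0 ∧ b = 1) ∨ (a = 1 ∧ b = 2) ∨ (a = 2 ∧ b = 0) := by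
    intro a b
    rw [hsg]
    fin_cases a <;> fin_cases b <;> simp
  by_cases hcd : c = d
  · subst hcd
    have h1 : E = 1 := by rw [hE]; exact Finset.prod_eq_one fun i _ => (hdiag (c i)).1
    have h2 : P = 0 := by rw [hP]; exact Finset.sum_eq_zero fun i _ => ((hdiag (c i)).2 (s i)).1
    have h3 : Q = 0 := by rw [hQ]; exact Finset.sum_eq_zero fun i _ => ((hdiag (c i)).2 (s i)).2
    rw [h1, h2, h3]
    simp [pow_two]
  · rw [if_neg hcd]
    by_contra hne
    have hE0 : E ≠ 0 := by
      intro h0; apply hne; rw [h0, zero_mul]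
    have hP0 : P = 0 := by
      by_contra h0; apply hne; rw [if_neg h0, zero_mul, mul_zero]
    have hQ0 : Q = 0 := by
      by_contra h0; apply hne; rw [if_neg h0, mul_zero, mul_zero]
    have hcompat : ∀ i, d i = c i ∨ (c i = 0 ∧ d i = 1) ∨ (c i = 1 ∧ d i = 2) ∨
        (c i = 2 ∧ d i = 0) := fun i =>
      hsg0 (c i) (d i) fun h0 => hE0 (hE ▸ Finset.prod_eq_zero (Finset.mem_univ i) h0)
    have hP' : P = ∑ i ∈ univ.filter (fun i => c i = 0 ∧ d i = 1), s i -
        ∑ i ∈ univ.filter (fun i => c i = 1 ∧ d i = 2), s i := by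
      rw [hP, hp, Finset.sum_filter, Finset.sum_filter, ← Finset.sum_sub_distrib]
    have hQ' : Q = ∑ i ∈ univ.filter (fun i => c i = 2 ∧ d i = 0), s i -
        ∑ i ∈ univ.filter (fun i => c i = 1 ∧ d i = 2), s i := by
      rw [hQ, hq, Finset.sum_filter, Finset.sum_filter, ← Finset.sum_sub_distrib]
    rw [hP'] at hP0
    rw [hQ'] at hQ0
    exact ntde_contra s hS c d hcd hcompat (sub_eq_zero.mp hP0) (sub_eq_zero.mp hQ0).symm

/-- The counting form of the theorem for an indexed family `s : ι → G` with the
no-three-disjoint-equivoluminous-subsets property: `3^|ι| ≤ |G|² · 2^|ι|`. -/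
theorem three_pow_card_le {ι G : Type*} [Fintype ι] [DecidableEq ι] [AddCommGroup G] [Fintype G]
    [DecidableEq G] (s : ι → G)
    (hS : ∀ I₁ I₂ I₃ : Finset ι, Disjoint I₁ I₂ → Disjoint I₂ I₃ → Disjoint I₁ I₃ →
      ¬ (I₁ = ∅ ∧ I₂ = ∅ ∧ I₃ = ∅) →
      ¬ (∑ i ∈ I₁, s i = ∑ i ∈ I₂, s i ∧ ∑ i ∈ I₂, s i = ∑ i ∈ I₃, s i)) :
    3 ^ Fintype.card ι ≤ Fintype.card G ^ 2 * 2 ^ Fintype.card ι := by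
  set col : AddChar G ℂ → AddChar G ℂ → G → Fin 2 → Fin 3 → ℂ :=
    fun χ ψ g => ![![1, 0, -ψ g], ![0, 1, ψ g * χ g]] with hcol
  set row : AddChar G ℂ → AddChar G ℂ → G → Fin 2 → Fin 3 → ℂ :=
    fun χ ψ g => ![![1, χ g, 0], ![0, 1, χ (-g) * ψ (-g)]] with hrow
  have key := kernel_sum s hS col row hcol hrow
  have hG : ((Fintype.card G : ℂ) ^ 2) ≠ 0 :=
    pow_ne_zero _ (Nat.cast_ne_zero.mpr Fintype.card_ne_zero)
  have hspan : ∀ c : ι → Fin 3, (fun d => if c = d then (1 : ℂ) else 0) ∈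
      Submodule.span ℂ (Set.range (fun (j : AddChar G ℂ × AddChar G ℂ × (ι → Fin 2))
        (d : ι → Fin 3) => ∏ i, row j.1 j.2.1 (s i) (j.2.2 i) (d i))) := by
    intro c
    have hfun : (fun d => if c = d then (1 : ℂ) else 0) =
        ((Fintype.card G : ℂ) ^ 2)⁻¹ • ∑ χ : AddChar G ℂ, ∑ ψ : AddChar G ℂ, ∑ ε : ι → Fin 2,
          (∏ i, col χ ψ (s i) (ε i) (c i)) • (fun d => ∏ i, row χ ψ (s i) (ε i) (d i)) := by
      funext d
      simp only [Pi.smul_apply, Finset.sum_apply, smul_eq_mul]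
      rw [key c d]
      split_ifs
      · rw [inv_mul_cancel₀ hG]
      · rw [mul_zero]
    rw [hfun]
    refine Submodule.smul_mem _ _ (Submodule.sum_mem _ fun χ _ => Submodule.sum_mem _ fun ψ _ =>
      Submodule.sum_mem _ fun ε _ => Submodule.smul_mem _ _ (Submodule.subset_span ?_))
    exact ⟨(χ, ψ, ε), rfl⟩
  have h := card_le_of_indicator_mem_span _ hspan
  rw [Fintype.card_fun, Fintype.card_fin, Fintype.card_prod, Fintype.card_prod, Fintype.card_fun,
    Fintype.card_fin, AddChar.card_eq] at h
  calc 3 ^ Fintype.card ι ≤ Fintype.card G * (Fintype.card G * 2 ^ Fintype.card ι) := h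
    _ = Fintype.card G ^ 2 * 2 ^ Fintype.card ι := by ring

end DesignFlatteningEquivoluminousDeterminant

open DesignFlatteningEquivoluminousDeterminant in
/-- **Route DesignFlattening, support `EquivoluminousDeterminant`** (stmt-MatrixMultiplication-11017,
card Theorem (A′)): a subset `S` of a finite abelian group `G` with no three pairwise disjoint, not
all empty, subsets of equal sum satisfies `(3/2)^|S| ≤ |G|²`. -/
theorem equivoluminousDeterminant_proof :
    Summit.MatrixMultiplication.MatrixMultiplication.Theses.DesignFlattening.EquivoluminousDeterminant := by
  unfold Summit.MatrixMultiplication.MatrixMultiplication.Theses.DesignFlattening.EquivoluminousDeterminant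
  intro G _ _ _ S hS
  have hS' : ∀ I₁ I₂ I₃ : Finset S, Disjoint I₁ I₂ → Disjoint I₂ I₃ → Disjoint I₁ I₃ →
      ¬ (I₁ = ∅ ∧ I₂ = ∅ ∧ I₃ = ∅) →
      ¬ (∑ i ∈ I₁, (i : G) = ∑ i ∈ I₂, (i : G) ∧ ∑ i ∈ I₂, (i : G) = ∑ i ∈ I₃, (i : G)) := by
    intro I₁ I₂ I₃ h12 h23 h13 hne
    have h := hS (I₁.map (Function.Embedding.subtype _)) (I₂.map (Function.Embedding.subtype _))
      (I₃.map (Function.Embedding.subtype _))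
      (fun x hx => Finset.property_of_mem_map_subtype I₁ hx)
      (fun x hx => Finset.property_of_mem_map_subtype I₂ hx)
      (fun x hx => Finset.property_of_mem_map_subtype I₃ hx)
      ((Finset.disjoint_map _).mpr h12) ((Finset.disjoint_map _).mpr h23)
      ((Finset.disjoint_map _).mpr h13)
      (by simpa only [Finset.map_eq_empty] using hne)
    simpa only [Finset.sum_map, Function.Embedding.coe_subtype] using h
  have h := three_pow_card_le (fun i : S => (i : G)) hS'
  rw [Fintype.card_coe] at h
  have h' : (3 : ℝ) ^ S.card ≤ (Fintype.card G : ℝ) ^ 2 * 2 ^ S.card := by exact_mod_cast h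
  rw [div_pow, div_le_iff₀ (by positivity)]
  exact h'

end Summit.MatrixMultiplication.MatrixMultiplication.Theorems
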